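import Summits.QuantumFields.YangMills.Theorems.UnitScaleTiltProp8ChartKernelFlatT3
import Summits.QuantumFields.YangMills.Theorems.UnitScaleTiltProp8ChartRemainderColumnLetterFlat
import Summits.QuantumFields.YangMills.Theorems.AlphaInputsT3ACv3StartS6Numerals
import HarnessLib

/-!
# Route `UnitScaleTilt`, crux K1 «MinimiserStabilityRegPr» (stmt-QuantumFields-19200), stub V2′ `stub_halvingStep`, C_E node after RULING g26-№6∕№16 — (S4′) THE SOCKET:
# **THE (X2-C′-KERNEL)♭ ROW WITH NUMERAL CONSTANTS ON THE WEIGHTED BALL, AND THE (X2-C′)♭ COLUMN RESIDUE OF FILE E, UNCONDITIONALLY**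
# (✓`kernel157_flat'` ∘ windows := one radius `R♭(L) = (29491200000·L⁴)⁻¹`, constant `C₃♭(L) ≤ 9830400000·L⁴`; then ★w8-19936 g0's ✓`hCcolFlatBall_of_readKernel157` ∘ hCd♭)

Cell `ym3-torus` (HUMAN RULING D-0037: YM₃ on the torus is ladder rung R3, not the Clay problem), width seat `ym-ust-19936-w5` gen 3; `--supports stmt-QuantumFields-19200
--as helper`; def-free, 0 sorry.

WHY.  ✓`ChartKernelFlat.kernel157_flat` ([Balaban1985Averaging] Prop. 5 (157) for `chartLogFlat`, ✓p617042) carries four k-free windows in `ρ` and an `L`-rational constant;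
the consumer of record (census S8 socket, ✓`ChartRemainderColumnLetterFlat.hCcolFlatBall_of_readKernel157`, v1.2 of ★w8-19936 g0) wants ONE radius `R′` and ONE constant `C₃`.
On the `T³` carrier `ℓ = (d+2)L = 5L`, so everything is a polynomial in `L`: `A′ = 153600000·L³`, `C₃♭ = 2457600000·L⁴/(11/12 − 2/L) ≤ 9830400000·L⁴` (`L ≥ 3`), and all four
windows follow from `ρ < R♭ := (29491200000·L⁴)⁻¹` (the binding one is `A′·16·Lρ ≤ 1/12`, met with equality at `R♭`).
WHAT.  (`ℓ = 5L` and `3 ≤ L` are ✓`TubeStart.cast_d_add_two_mul_L`∕`three_le_T3Family_L`); `kernelA_eq`∕`kernelConst_eq`∕`kernelConst_le` (the constant of ✓`kernel157_flat` is `2457600000·L⁴/(1 − 2/L − 1/12) ≤ 9830400000·L⁴`); `windows_of_lt_radFlat`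
(the four windows from `ρ < R♭`); ★★ `kernel157_flat_ball` — EXACTLY the `hKball` binder of ✓`hCcolFlatBall_of_readKernel157` with `R′ := R♭(L)`, `C₃ := 9830400000·L⁴`
(READ hypothesis accepted and unused: the row holds at every bond); ★★★ `hCcolFlatBall_of_adm22` — THE (X2-C′)♭ COLUMN RESIDUE OF FILE E WITH NO KERNEL∕DIFFERENTIABILITY
HYPOTHESIS LEFT: for every admissible cube family and the weights of record, `∀ Z ρ′, ρ′ < R♭ → (∀ b, w 1 b·‖Z b‖ ≤ ρ′) → ∀ δ, Σ_i η⁻³(Lʲη)⁻¹‖∂C♭(Z)[δ]_i‖ ≤ 7·(9830400000·L⁴)·ρ′·Σ_b (w 3 b)⁻¹‖δ b‖`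
(hCd♭ ✓`differentiableOn_chartLogFlat_weightedBall_of_adm22` at radius `R♭`, B1 ✓`norm_dbarAvgU_sub_one_le`).
HONEST SCOPE.  Constants bookkeeping + two `exact`s; the mathematics is in ✓p617042 and its imports.  NOT a claim about the stub, the crux, the rung or the mass gap.

References: T. Bałaban, CMP **98** (1985) 17–51 [Balaban1985Averaging] (Prop. 5 (157) p.42); CMP **102** (1985) 277–309 [Balaban1985Variational] ((72)–(73), (85)–(86)).
-/

noncomputable section

open scoped BigOperators Matrix.Norms.L2Operator
open NormedSpace Metric Filter Topology Set

namespace Summit.QuantumFields.YangMills.Theorems.ChartKernelFlat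

open Literature.MathematicalPhysics.QuantumFieldTheory.Balaban1983to89
open T4Continuum BlockAveraging MatrixLog
open LatticeFieldCalculus (bondAvg bondAvgIter)
open B5Eq118OneStroke (iterBlockOf)
open B6SectADomainsV1 (Domains)
open B6SectAOperatorsV1 (BondIdx)
open T3ContinuumYM3Torus (T3Family)
open Summit.QuantumFields.YangMills.Theorems.FlatCubeOpsText (Adm22 IsLevWeight)
open Summit.QuantumFields.YangMills.Theorems.Prop8ChartDoubleBar
open Summit.QuantumFields.YangMills.Theorems.ChartRemainderColumnLetterFlat (hCcolFlatBall_of_readKernel157)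
open Summit.QuantumFields.YangMills.Theorems.TubeStart (three_le_T3Family_L cast_d_add_two_mul_L)

variable (F : T3Family) (n K : ℕ)

/-! ## §1 Constants on the `T³` carrier: `ℓ = 5L`, the kernel constant, the radius -/

/-- The constant `A′` of ✓`kernel157_flat` on the `T³` carrier is `153600000·L³`. [folklore] -/
theorem kernelA_eq :
    (2560 * ((((F.P K).d + 2) * (F.P K).L : ℕ) : ℝ) / (400 * ((((F.P K).d + 2) * (F.P K).L : ℕ) : ℝ))⁻¹) * (2 * ((F.P K).d : ℝ)) /
        ((F.L : ℝ) ^ 2 * ((F.L : ℝ) ^ (F.P K).d)⁻¹) = 153600000 * (F.L : ℝ) ^ 3 := by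
  have hL0 : (0 : ℝ) < (F.L : ℝ) := by linarith [three_le_T3Family_L F]
  have hd : ((F.P K).d : ℝ) = 3 := by rw [T3Family.P_d]; norm_num
  have hLd : (F.L : ℝ) ^ (F.P K).d = (F.L : ℝ) ^ 3 := by rw [T3Family.P_d]
  rw [cast_d_add_two_mul_L, hd, hLd]
  have hL : (F.L : ℝ) ≠ 0 := hL0.ne'
  field_simp
  ring

/-- The constant of ✓`kernel157_flat` on the `T³` carrier: `16·A′·L/(1 − 2/L − 1/12) = 2457600000·L⁴/(1 − 2/L − 1/12)`. [folklore] -/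
theorem kernelConst_eq :
    16 * ((2560 * ((((F.P K).d + 2) * (F.P K).L : ℕ) : ℝ) / (400 * ((((F.P K).d + 2) * (F.P K).L : ℕ) : ℝ))⁻¹) * (2 * ((F.P K).d : ℝ)) /
        ((F.L : ℝ) ^ 2 * ((F.L : ℝ) ^ (F.P K).d)⁻¹)) * (F.L : ℝ) / (1 - 2 / (F.L : ℝ) - 1 / 12) =
      2457600000 * (F.L : ℝ) ^ 4 / (1 - 2 / (F.L : ℝ) - 1 / 12) := by
  rw [kernelA_eq]; ring

/-- ★ The constant of ✓`kernel157_flat` is at most `9830400000·L⁴` (`1 − 2/L − 1/12 ≥ 1/4` for `L ≥ 3`). [folklore] -/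
theorem kernelConst_le :
    16 * ((2560 * ((((F.P K).d + 2) * (F.P K).L : ℕ) : ℝ) / (400 * ((((F.P K).d + 2) * (F.P K).L : ℕ) : ℝ))⁻¹) * (2 * ((F.P K).d : ℝ)) /
        ((F.L : ℝ) ^ 2 * ((F.L : ℝ) ^ (F.P K).d)⁻¹)) * (F.L : ℝ) / (1 - 2 / (F.L : ℝ) - 1 / 12) ≤ 9830400000 * (F.L : ℝ) ^ 4 := by
  have hL3 := three_le_T3Family_L F
  have hL0 : (0 : ℝ) < (F.L : ℝ) := by linarith
  have hq : 1 / 4 ≤ 1 - 2 / (F.L : ℝ) - 1 / 12 := by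
    have : 2 / (F.L : ℝ) ≤ 2 / 3 := div_le_div_of_nonneg_left (by norm_num) (by norm_num) hL3
    linarith
  have hden : 0 < 1 - 2 / (F.L : ℝ) - 1 / 12 := by linarith
  rw [kernelConst_eq, div_le_iff₀ hden]
  calc 2457600000 * (F.L : ℝ) ^ 4 = 9830400000 * (F.L : ℝ) ^ 4 * (1 / 4) := by ring
    _ ≤ 9830400000 * (F.L : ℝ) ^ 4 * (1 - 2 / (F.L : ℝ) - 1 / 12) := mul_le_mul_of_nonneg_left hq (by positivity)

/-- ★ **THE FOUR WINDOWS OF ✓`kernel157_flat` FROM ONE RADIUS**: `0 ≤ ρ < R♭(L) := (29491200000·L⁴)⁻¹` implies `121600ℓ²Lρ ≤ 1`, `51200ℓLρ ≤ 1`, `A′·(16·Lρ) ≤ 1/12`, `Lρ ≤ 1/20`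
(the third with equality at `R♭`). [folklore] -/
theorem windows_of_lt_radFlat {ρ : ℝ} (hρ0 : 0 ≤ ρ) (hρ : ρ < (29491200000 * (F.L : ℝ) ^ 4)⁻¹) :
    121600 * ((((F.P K).d + 2) * (F.P K).L : ℕ) : ℝ) ^ 2 * (F.L : ℝ) * ρ ≤ 1 ∧
    51200 * ((((F.P K).d + 2) * (F.P K).L : ℕ) : ℝ) * (F.L : ℝ) * ρ ≤ 1 ∧
    (2560 * ((((F.P K).d + 2) * (F.P K).L : ℕ) : ℝ) / (400 * ((((F.P K).d + 2) * (F.P K).L : ℕ) : ℝ))⁻¹) * (2 * ((F.P K).d : ℝ)) /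
        ((F.L : ℝ) ^ 2 * ((F.L : ℝ) ^ (F.P K).d)⁻¹) * (16 * ((F.L : ℝ) * ρ)) ≤ 1 / 12 ∧
    (F.L : ℝ) * ρ ≤ 1 / 20 := by
  have hL3 := three_le_T3Family_L F
  have hL0 : (0 : ℝ) < (F.L : ℝ) := by linarith
  have hL1 : (1 : ℝ) ≤ (F.L : ℝ) := by linarith
  set Lr : ℝ := (F.L : ℝ) with hLr
  -- `29491200000·L⁴·ρ < 1`
  have hmain : 29491200000 * Lr ^ 4 * ρ ≤ 1 := by
    have hpos : (0 : ℝ) < 29491200000 * Lr ^ 4 := by positivity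
    have h := (mul_lt_mul_of_pos_left hρ hpos).le
    rwa [mul_inv_cancel₀ hpos.ne'] at h
  -- monotonicity in the power of `L`
  have hm3 : Lr ^ 3 * ρ ≤ Lr ^ 4 * ρ := mul_le_mul_of_nonneg_right (pow_le_pow_right₀ hL1 (by norm_num)) hρ0
  have hm2 : Lr ^ 2 * ρ ≤ Lr ^ 4 * ρ := mul_le_mul_of_nonneg_right (pow_le_pow_right₀ hL1 (by norm_num)) hρ0
  have hm1 : Lr * ρ ≤ Lr ^ 4 * ρ := by
    have h := mul_le_mul_of_nonneg_right (pow_le_pow_right₀ hL1 (show 1 ≤ 4 by norm_num)) hρ0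
    rwa [pow_one] at h
  have h4ρ : 0 ≤ Lr ^ 4 * ρ := by positivity
  rw [kernelA_eq, cast_d_add_two_mul_L]
  refine ⟨?_, ?_, ?_, ?_⟩
  · calc 121600 * (5 * Lr) ^ 2 * Lr * ρ = 3040000 * (Lr ^ 3 * ρ) := by ring
      _ ≤ 3040000 * (Lr ^ 4 * ρ) := by linarith
      _ ≤ 1 := by linarith
  · calc 51200 * (5 * Lr) * Lr * ρ = 256000 * (Lr ^ 2 * ρ) := by ring
      _ ≤ 256000 * (Lr ^ 4 * ρ) := by linarith
      _ ≤ 1 := by linarith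
  · calc 153600000 * Lr ^ 3 * (16 * (Lr * ρ)) = (29491200000 * Lr ^ 4 * ρ) * (1 / 12) := by ring
      _ ≤ 1 * (1 / 12) := mul_le_mul_of_nonneg_right hmain (by norm_num)
      _ = 1 / 12 := by ring
  · calc Lr * ρ ≤ Lr ^ 4 * ρ := hm1
      _ ≤ 1 / 20 := by linarith

/-! ## §2 The kernel row on the weighted ball with numeral constants (the `hKball` binder of record) -/

/-- ★★ **THE (X2-C′-KERNEL)♭ ROW ON THE WEIGHTED BALL, NUMERAL CONSTANTS** — exactly the `hKball` binder of ✓`ChartRemainderColumnLetterFlat.hCcolFlatBall_of_readKernel157` with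
`R′ := R♭(L) = (29491200000·L⁴)⁻¹` and `C₃ := 9830400000·L⁴`: for an admissible cube family `D` (`D.k = K − n`, `Adm22 D R″ M`, `2L ≤ R″M + 1`), the weights of record `w`, every `Z`
with `w 1 b·‖Z b‖ ≤ ρ′` for all `b`, `0 ≤ ρ′ < R♭(L)`, every bond `b` (READ by `i` or not), matrix `M`, index `i = (j,c)`:
`‖fderiv ℂ (chartLogFlat η D − fderiv ℂ (chartLogFlat η D) 0) Z (e_b M) i‖ ≤ 9830400000·L⁴·ρ′·η·((Lʲ)⁻¹)²·‖M‖`, `η = (L⁻¹)^{K−n}` (✓`kernel157_flat'` through §1).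
[cite: Balaban1985Averaging, Prop. 5 (157) p.42; Balaban1985Variational, (72)-(73) p.289] -/
theorem kernel157_flat_ball [DecidableEq (PBond (F.P K) 0)] (D : Domains (F.P K)) (hDk : D.k = K - n) {R'' Mb : ℕ} (hAdm : Adm22 D R'' Mb)
    (hRM : 2 * (F.P K).L ≤ R'' * Mb + 1) {w : ℕ → PBond (F.P K) 0 → ℝ} (hw : IsLevWeight F n K D w) :
    ∀ (Z : PBond (F.P K) 0 → Matrix (Fin 2) (Fin 2) ℂ) (ρ' : ℝ), 0 ≤ ρ' → ρ' < (29491200000 * (F.L : ℝ) ^ 4)⁻¹ → (∀ b, w 1 b * ‖Z b‖ ≤ ρ') →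
      ∀ (b : PBond (F.P K) 0) (M : Matrix (Fin 2) (Fin 2) ℂ) (i : BondIdx D),
      ((iterBlockOf (i.1.1 : ℕ) b.src = i.1.2.src ∨ iterBlockOf (i.1.1 : ℕ) b.src = i.1.2.tgt) ∧
        (iterBlockOf (i.1.1 : ℕ) b.tgt = i.1.2.src ∨ iterBlockOf (i.1.1 : ℕ) b.tgt = i.1.2.tgt)) →
      ‖fderiv ℂ (fun A : PBond (F.P K) 0 → Matrix (Fin 2) (Fin 2) ℂ =>
            chartLogFlat (((F.L : ℝ)⁻¹) ^ (K - n)) D A -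
              fderiv ℂ (chartLogFlat (((F.L : ℝ)⁻¹) ^ (K - n)) D :
                (PBond (F.P K) 0 → Matrix (Fin 2) (Fin 2) ℂ) → BondIdx D → Matrix (Fin 2) (Fin 2) ℂ) 0 A) Z (Pi.single b M) i‖
        ≤ 9830400000 * (F.L : ℝ) ^ 4 * ρ' * ((F.L : ℝ)⁻¹) ^ (K - n) * (((F.L : ℝ) ^ (i.1.1 : ℕ))⁻¹) ^ 2 * ‖M‖ := by
  intro Z ρ' hρ0 hρR hZ b M i _hread
  obtain ⟨h1, h2, h3, h4⟩ := windows_of_lt_radFlat F K hρ0 hρR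
  have hL0 : (0 : ℝ) < (F.L : ℝ) := by linarith [three_le_T3Family_L F]
  refine (kernel157_flat' F n K D hDk hAdm hRM hw hρ0 h1 h2 h3 h4 Z hZ b M i).trans ?_
  have hC := kernelConst_le F K
  have hrest : 0 ≤ ρ' * ((F.L : ℝ)⁻¹) ^ (K - n) * (((F.L : ℝ) ^ (i.1.1 : ℕ))⁻¹) ^ 2 * ‖M‖ := by positivity
  calc _ = (16 * ((2560 * ((((F.P K).d + 2) * (F.P K).L : ℕ) : ℝ) / (400 * ((((F.P K).d + 2) * (F.P K).L : ℕ) : ℝ))⁻¹) * (2 * ((F.P K).d : ℝ)) /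
          ((F.L : ℝ) ^ 2 * ((F.L : ℝ) ^ (F.P K).d)⁻¹)) * (F.L : ℝ) / (1 - 2 / (F.L : ℝ) - 1 / 12)) *
          (ρ' * ((F.L : ℝ)⁻¹) ^ (K - n) * (((F.L : ℝ) ^ (i.1.1 : ℕ))⁻¹) ^ 2 * ‖M‖) := by ring
    _ ≤ (9830400000 * (F.L : ℝ) ^ 4) * (ρ' * ((F.L : ℝ)⁻¹) ^ (K - n) * (((F.L : ℝ) ^ (i.1.1 : ℕ))⁻¹) ^ 2 * ‖M‖) :=
        mul_le_mul_of_nonneg_right hC hrest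
    _ = _ := by ring

/-! ## §3 The (X2-C′)♭ column residue of FILE E, unconditionally -/

/-- ★★★ **THE (X2-C′)♭ COLUMN RESIDUE ON THE WEIGHTED BALL WITH NO HYPOTHESIS LEFT** (census S8 socket closed by name: ★w8-19936 g0's ✓`hCcolFlatBall_of_readKernel157` fed with hCd♭
✓`differentiableOn_chartLogFlat_weightedBall_of_adm22` at radius `R♭(L)` and the kernel row `kernel157_flat_ball`): for every admissible cube family `D` (`D.k = K − n`, `Adm22 D R″ M`,
`2L ≤ R″M + 1`) and the weights of record, `∀ Z ρ′, ρ′ < R♭(L) → (∀ b, w 1 b·‖Z b‖ ≤ ρ′) → ∀ δ, Σ_i η⁻³·(Lʲη)⁻¹·‖fderiv ℂ C♭ Z δ i‖ ≤ 7·(9830400000·L⁴)·ρ′·Σ_b (w 3 b)⁻¹·‖δ b‖`,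
`C♭ = chartLogFlat η D − fderiv ℂ (chartLogFlat η D) 0`, `η = (L⁻¹)^{K−n}`, `R♭(L) = (29491200000·L⁴)⁻¹` — k-, n-, K-, D-uniform constants depending on `L` only.
[cite: Balaban1985Averaging, Prop. 5 (157) p.42; Balaban1985Variational, (72)-(73) p.289, (85)-(86) p.291] -/
theorem hCcolFlatBall_of_adm22 [DecidableEq (PBond (F.P K) 0)] (D : Domains (F.P K)) (hDk : D.k = K - n) {R'' Mb : ℕ} (hAdm : Adm22 D R'' Mb)
    (hRM : 2 * (F.P K).L ≤ R'' * Mb + 1) {w : ℕ → PBond (F.P K) 0 → ℝ} (hw : IsLevWeight F n K D w) :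
    ∀ (Z : PBond (F.P K) 0 → Matrix (Fin 2) (Fin 2) ℂ) (ρ' : ℝ), ρ' < (29491200000 * (F.L : ℝ) ^ 4)⁻¹ → (∀ b, w 1 b * ‖Z b‖ ≤ ρ') →
      ∀ δ : PBond (F.P K) 0 → Matrix (Fin 2) (Fin 2) ℂ,
      ∑ i : BondIdx D, ((((F.L : ℝ)⁻¹) ^ (K - n)) ^ 3)⁻¹ * ((F.L : ℝ) ^ (i.1.1 : ℕ) * ((F.L : ℝ)⁻¹) ^ (K - n))⁻¹ *
          ‖fderiv ℂ (fun A : PBond (F.P K) 0 → Matrix (Fin 2) (Fin 2) ℂ =>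
              chartLogFlat (((F.L : ℝ)⁻¹) ^ (K - n)) D A -
                fderiv ℂ (chartLogFlat (((F.L : ℝ)⁻¹) ^ (K - n)) D :
                  (PBond (F.P K) 0 → Matrix (Fin 2) (Fin 2) ℂ) → BondIdx D → Matrix (Fin 2) (Fin 2) ℂ) 0 A) Z δ i‖
        ≤ 7 * (9830400000 * (F.L : ℝ) ^ 4) * ρ' * ∑ b, (w 3 b)⁻¹ * ‖δ b‖ := by
  have hL3 := three_le_T3Family_L F
  have hL0 : (0 : ℝ) < (F.L : ℝ) := by linarith
  -- hCd♭ at radius `R♭(L)`: `16·3800·ℓ²·L·R♭ ≤ 1`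
  have hstep : ∀ (j : ℕ), j + 1 ≤ (F.P K).m + (F.P K).K → ∀ (S : GaugeField (F.P K) j (Matrix (Fin 2) (Fin 2) ℂ)ˣ) (c : PBond (F.P K) (j + 1)) (s : ℝ), 0 ≤ s →
      48 * ((((F.P K).d + 2) * (F.P K).L : ℕ) : ℝ) * s ≤ 1 →
      (∀ b : PBond (F.P K) j, (blockOf b.src = c.src ∨ blockOf b.src = c.tgt) → (blockOf b.tgt = c.src ∨ blockOf b.tgt = c.tgt) →
        ‖((S b : (Matrix (Fin 2) (Fin 2) ℂ)ˣ) : Matrix (Fin 2) (Fin 2) ℂ) - 1‖ ≤ s) →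
      ‖((dbarAvgU S c : (Matrix (Fin 2) (Fin 2) ℂ)ˣ) : Matrix (Fin 2) (Fin 2) ℂ) - 1‖ ≤ ((F.P K).L : ℝ) * s + 3800 * ((((F.P K).d + 2) * (F.P K).L : ℕ) : ℝ) ^ 2 * s ^ 2 :=
    fun j hj S c s hs0 hℓs hS => norm_dbarAvgU_sub_one_le hj c hs0 hℓs hS
  have hRball : 16 * 3800 * ((((F.P K).d + 2) * (F.P K).L : ℕ) : ℝ) ^ 2 * (F.L : ℝ) * (29491200000 * (F.L : ℝ) ^ 4)⁻¹ ≤ 1 := by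
    rw [cast_d_add_two_mul_L]
    have hpos : (0 : ℝ) < 29491200000 * (F.L : ℝ) ^ 4 := by positivity
    rw [← div_eq_mul_inv, div_le_one hpos]
    have hL1 : (1 : ℝ) ≤ (F.L : ℝ) := by linarith
    have hm : (F.L : ℝ) ^ 3 ≤ (F.L : ℝ) ^ 4 := pow_le_pow_right₀ hL1 (by norm_num)
    calc 16 * 3800 * (5 * (F.L : ℝ)) ^ 2 * (F.L : ℝ) = 1520000 * (F.L : ℝ) ^ 3 := by ring
      _ ≤ 1520000 * (F.L : ℝ) ^ 4 := by linarith
      _ ≤ 29491200000 * (F.L : ℝ) ^ 4 := by nlinarith [pow_nonneg hL0.le 4]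
  have hdiff := (differentiableOn_chartLogFlat_weightedBall_of_adm22 F n K D hDk hAdm hRM hw (C₁ := 3800) (by norm_num) hstep hRball).1
  exact hCcolFlatBall_of_readKernel157 F n K D hDk hw (C₃ := 9830400000 * (F.L : ℝ) ^ 4) (by positivity) le_rfl hdiff
    (kernel157_flat_ball F n K D hDk hAdm hRM hw)

/-! ## v1.1 — the same residue with FILE E's weight floor written verbatim (`(L^{K−n})³·(Lʲη)⁻¹` instead of `((η)³)⁻¹·(Lʲη)⁻¹`) -/

/-- ★★★ **THE (X2-C′)♭ COLUMN RESIDUE, FILE-E FLOOR SPELLING**: `hCcolFlatBall_of_adm22` with the index weight written as FILE E (✓`exists_hWq_dressed_cubeSeq_T3_chartOfRecord`) displays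
its floor `hu`, namely `(L^{K−n})³·(Lʲ·η)⁻¹` (`= η⁻³(Lʲη)⁻¹`, `η = (L⁻¹)^{K−n}`) — so FILE E's `hCcol` binder at `u := floor` is this theorem by `exact`, with `C₃ := 7·9830400000·L⁴` and
`R′ := (29491200000·L⁴)⁻¹`. [cite: Balaban1985Averaging, Prop. 5 (157) p.42; Balaban1985Variational, (72)-(73) p.289, (85)-(86) p.291] -/
theorem hCcolFlatBall_of_adm22_floor [DecidableEq (PBond (F.P K) 0)] (D : Domains (F.P K)) (hDk : D.k = K - n) {R'' Mb : ℕ} (hAdm : Adm22 D R'' Mb)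
    (hRM : 2 * (F.P K).L ≤ R'' * Mb + 1) {w : ℕ → PBond (F.P K) 0 → ℝ} (hw : IsLevWeight F n K D w) :
    ∀ (Z : PBond (F.P K) 0 → Matrix (Fin 2) (Fin 2) ℂ) (ρ' : ℝ), ρ' < (29491200000 * (F.L : ℝ) ^ 4)⁻¹ → (∀ b, w 1 b * ‖Z b‖ ≤ ρ') →
      ∀ δ : PBond (F.P K) 0 → Matrix (Fin 2) (Fin 2) ℂ,
      ∑ i : BondIdx D, ((F.L : ℝ) ^ (K - n)) ^ 3 * ((F.L : ℝ) ^ (i.1.1 : ℕ) * ((F.L : ℝ)⁻¹) ^ (K - n))⁻¹ *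
          ‖fderiv ℂ (fun A : PBond (F.P K) 0 → Matrix (Fin 2) (Fin 2) ℂ =>
              chartLogFlat (((F.L : ℝ)⁻¹) ^ (K - n)) D A -
                fderiv ℂ (chartLogFlat (((F.L : ℝ)⁻¹) ^ (K - n)) D :
                  (PBond (F.P K) 0 → Matrix (Fin 2) (Fin 2) ℂ) → BondIdx D → Matrix (Fin 2) (Fin 2) ℂ) 0 A) Z δ i‖
        ≤ 7 * (9830400000 * (F.L : ℝ) ^ 4) * ρ' * ∑ b, (w 3 b)⁻¹ * ‖δ b‖ := by
  intro Z ρ' hρ hZ δ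
  have h := hCcolFlatBall_of_adm22 F n K D hDk hAdm hRM hw Z ρ' hρ hZ δ
  have hpow : ((((F.L : ℝ)⁻¹) ^ (K - n)) ^ 3)⁻¹ = ((F.L : ℝ) ^ (K - n)) ^ 3 := by
    rw [inv_pow, inv_pow, inv_inv]
  simpa only [hpow] using h

end Summit.QuantumFields.YangMills.Theorems.ChartKernelFlat

end
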